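import Summits.SmoothPoincare4.SmoothPoincare4.Theorems.CongruenceShadowsAgkCor6SufficiencySpineDefs
import Literature.Topology.FourManifolds.TraceMorseFunction
import Literature.Topology.FourManifolds.RegularLevelSplitting
import Literature.Topology.FourManifolds.ConnectedSum

/-!
# Cores of a normalised spine presentation — helpers for stub `stub_cores` of line
`lp-by-sphere-system-surgery` (crux `AgkCor6Sufficiency`, item stmt-SmoothPoincare4-10894, routes
CongruenceShadows / GroupTrisection; lead reshape r5, D)

For a normalised ambient Morse presentation `hP : SpinePresentation S u v ρ U O T₀ G k` of the
three sectors of a trisection of a closed `4`-manifold `X` (`…SpineDefs.lean`) and a scale `a > 0`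
such that all interior critical values of `G m` on `S m` lie below the level `lev = 1 - a/4`,
this file certifies the **cores** `{x ∈ S m | G m x ≤ lev}` as compact connected orientable
`1`-handlebodies (consumed by `superlevel_cores` of `…StubCores.lean`, which identifies the regular
superlevel set `{f ≥ 1/2}` of the level function with their disjoint union).  The results are
bundled in the registered helper stub `stub_coresMorseToolkit : CoresMorseToolkit`.

The core of `S m` is presented as the regular sublevel set `{G m|_U ≤ lev}` of the restriction
of `G m` to the OPEN sector `U = interior (S m)` (an open submanifold of `X`, boundaryless), so
that the tree's `RegularSublevel` API applies verbatim (Milnor, *Morse theory* (1963), Thm. 3.1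
with the Morse data, `RegularSublevel.morseData`; the Morse data of a restriction to an open
subset are those of the function, `TraceMorseFunction.lean`):
* `finite_interior_inter_criticalSet` — the interior critical points of `G m` are finite
  (they lie in the compact `S m ∖ T₀`, where they are nondegenerate, hence isolated: Milnor 1963,
  Cor. 2.3), so the counts `handleCount 1 k` bound the indices by `1` and give one minimum;
* `isConnected_preimage_Iic_of_isCompact` — Reeb's argument (Milnor 1963, proof of Thm. 4.1) for a
  COMPACT sublevel set of a function on a possibly non-compact manifold without boundary;
* `isRegularLevel_openSectorFun`, `compactSpace_core`, `connectedSpace_core`,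
  `isHandlebody_core`, `isOrientable_core` — the core `RegularSublevel` of `G m|_U` at `lev` is a
  compact connected `1`-handlebody, orientable (`RegularSublevel.isOrientable` from the
  orientation of `X` restricted to `U`).

## References

* J. Milnor, *Morse theory*, Ann. of Math. Studies 51 (1963), Cor. 2.3, Thm. 3.1, proof of
  Thm. 4.1. [Milnor1963]
* A. Abrams, D. Gay, R. Kirby, *Group trisections and smooth 4-manifolds*, Geom. Topol. 22
  (2018), proof of Thm. 5. [AbramsGayKirby2018]
-/

noncomputable section

-- the prescribed namespace `Summit.<P>.<Sub>.…` duplicates `SmoothPoincare4` (P = Sub)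
set_option linter.dupNamespace false

namespace Summit.SmoothPoincare4.SmoothPoincare4.Cruxes.AgkCor6Sufficiency.LpBySphereSystemSurgery

open Set Function Filter
open scoped _root_.Manifold _root_.ContDiff _root_.Topology
open Literature.Topology.FourManifolds

/-! ## 1. Reeb's argument for a compact sublevel set -/

section Reeb

variable {n : ℕ} {M : Type*} [TopologicalSpace M] [ChartedSpace (EuclideanSpace ℝ (Fin (n + 1))) M]

/-- **A compact sublevel set `{f ≤ a}` of a `C²` function with at most one critical point of
index `0`, on a manifold without boundary, is connected** (if nonempty): were it the disjoint
union of two closed nonempty pieces, minimising `f` on each piece would give two local minima of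
`f`, i.e. two critical points of index `0` (Reeb's argument; the tree's
`isConnected_preimage_Iic` assumes the ambient manifold compact, here only the sublevel set is).
[cite: Milnor1963, §3 and proof of Thm. 4.1] -/
theorem isConnected_preimage_Iic_of_isCompact {f : M → ℝ} {a : ℝ}
    (hf : ContMDiff (𝓡 (n + 1)) 𝓘(ℝ, ℝ) 2 f)
    (h0 : (criticalSetOfIndex (𝓡 (n + 1)) f 0).Subsingleton) (hK : IsCompact (f ⁻¹' Iic a))
    (hne : (f ⁻¹' Iic a).Nonempty) : IsConnected (f ⁻¹' Iic a) := by
  refine ⟨hne, ?_⟩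
  rw [isPreconnected_iff_subset_of_disjoint_closed]
  intro u v hu hv huv hdisj
  by_contra hcon
  rw [not_or] at hcon
  obtain ⟨hSu, hSv⟩ := hcon
  obtain ⟨xv, hxvS, hxvu⟩ := not_subset.1 hSu
  obtain ⟨xu, hxuS, hxuv⟩ := not_subset.1 hSv
  have hxv : xv ∈ v := (huv hxvS).resolve_left hxvu
  have hxu : xu ∈ u := (huv hxuS).resolve_right hxuv
  -- minimisers on the two pieces are local minima of `f`, hence critical points of index `0`
  have key : ∀ (u v : Set M), IsClosed u → IsClosed v → f ⁻¹' Iic a ⊆ u ∪ v →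
      f ⁻¹' Iic a ∩ (u ∩ v) = ∅ → (f ⁻¹' Iic a ∩ u).Nonempty →
      ∃ m ∈ f ⁻¹' Iic a ∩ u, m ∈ criticalSetOfIndex (𝓡 (n + 1)) f 0 := by
    intro u v hu hv huv hdisj hne
    obtain ⟨m, hm, hmin⟩ := (hK.inter_right hu).exists_isMinOn hne hf.continuous.continuousOn
    have hloc : IsLocalMin f m := isLocalMin_of_isMinOn_piece hv huv hdisj hm hmin
    exact ⟨m, hm, IsLocalMin.isMCriticalPt hloc, IsLocalMin.morseIndex_eq_zero (hf m) hloc⟩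
  obtain ⟨m, hm, hmc⟩ := key u v hu hv huv hdisj ⟨xu, hxuS, hxu⟩
  obtain ⟨m', hm', hm'c⟩ := key v u hv hu (by rwa [union_comm]) (by rwa [inter_comm v u])
    ⟨xv, hxvS, hxv⟩
  have hmm' : m = m' := h0 hmc hm'c
  have : m ∈ f ⁻¹' Iic a ∩ (u ∩ v) := ⟨hm.1, hm.2, hmm' ▸ hm'.2⟩
  rw [hdisj] at this
  exact this

end Reeb

/-! ## 2. Interior critical points of a normalised presentation -/

section Presentation

variable {X : Type} [TopologicalSpace X] [ChartedSpace (EuclideanSpace ℝ (Fin 4)) X]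
  {S : Fin 3 → Set X} {u v : X → ℝ} {ρ : X → X} {U O T₀ : Set X} {G : Fin 3 → X → ℝ} {k : ℕ}

namespace SpinePresentation

/-- A point of one sector is not interior to another. -/
theorem not_mem_interior_of_mem (hP : SpinePresentation S u v ρ U O T₀ G k) {m m' : Fin 3}
    (hmm' : m ≠ m') {x : X} (hx : x ∈ S m') : x ∉ interior (S m) :=
  hP.tri.not_mem_interior_of_mem hmm' hx

/-- A point of the central surface is not interior to any sector. -/
theorem not_mem_interior_of_mem_F (hP : SpinePresentation S u v ρ U O T₀ G k) {m : Fin 3} {x : X}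
    (hx : x ∈ ⋂ l, S l) : x ∉ interior (S m) :=
  hP.not_mem_interior_of_mem (m' := m + 1) (by revert m; decide) (mem_iInter.1 hx (m + 1))

/-- A point of `S m` with `G m < 1` is an interior point of `S m`. -/
theorem mem_interior_of_lt (hP : SpinePresentation S u v ρ U O T₀ G k) {m : Fin 3} {x : X}
    (hx : x ∈ S m) (hlt : G m x < 1) : x ∈ interior (S m) := by
  by_contra hni
  exact hlt.ne (hP.G_eq_one m x hx hni)

/-- **The interior critical points of `G m` on `S m` are finite**: they lie in the compact set
`S m ∖ T₀` (on `S m ∩ T₀ ∖ F` and at the non-interior points off `F` the function is regular,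
and the points of `F ⊆ T₀` are not interior), every critical point of `G m` in that set is an
interior one, hence nondegenerate and isolated among critical points. [cite: Milnor1963, Cor. 2.3] -/
theorem finite_interior_inter_criticalSet [IsManifold (𝓡 4) ∞ X]
    (hP : SpinePresentation S u v ρ U O T₀ G k) (m : Fin 3) :
    (interior (S m) ∩ criticalSet (𝓡 4) (G m)).Finite := by
  have h2 : (2 : WithTop ℕ∞) ≤ ∞ := by norm_cast
  set K : Set X := S m ∩ T₀ᶜ with hK
  have hKc : IsCompact K := (hP.tri.isCompact m).inter_right hP.isOpen_T₀.isClosed_compl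
  have hcl : IsClosed (criticalSet (𝓡 4) (G m)) :=
    isClosed_criticalSet_of_contMDiff (hP.contMDiff_G m) h2
  have hsub : interior (S m) ∩ criticalSet (𝓡 4) (G m) ⊆ criticalSet (𝓡 4) (G m) ∩ K := by
    rintro x ⟨hxi, hxc⟩
    refine ⟨hxc, interior_subset hxi, fun hxT => ?_⟩
    exact hP.regular_T₀ m x (interior_subset hxi) hxT (fun hF => hP.not_mem_interior_of_mem_F hF hxi)
      hxc
  have hint : ∀ x ∈ criticalSet (𝓡 4) (G m) ∩ K, x ∈ interior (S m) := by
    rintro x ⟨hxc, hxS, hxT⟩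
    by_contra hxi
    exact hP.regular_bd m x hxS hxi (fun hF => hxT (hP.F_subset_T₀ hF)) hxc
  have hcpt : IsCompact (criticalSet (𝓡 4) (G m) ∩ K) := hKc.inter_left hcl
  obtain ⟨t, -, hcover⟩ := hcpt.elim_nhds_subcover
    (fun p => {x | x = p ∨ ¬ IsMCriticalPt (𝓡 4) (G m) x}) fun p hp => by
      have := eventually_not_isMCriticalPt_of_nondegenerate (hP.contMDiff_G m) h2 hp.1
        (hP.nondeg m p (hint p hp) hp.1)
      rw [eventually_nhdsWithin_iff] at this
      filter_upwards [this] with x hx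
      by_cases hxp : x = p
      · exact Or.inl hxp
      · exact Or.inr (hx hxp)
  refine t.finite_toSet.subset fun x hx => ?_
  have hx' := hsub hx
  obtain ⟨p, hpt, hxp⟩ := mem_iUnion₂.1 (hcover hx')
  rcases hxp with rfl | h
  · exact hpt
  · exact absurd hx'.1 h

/-- The interior critical points of `G m` have Morse index `≤ 1` (the counts are
`handleCount 1 k`, which vanish from index `2` on, and the critical set is finite). -/
theorem morseIndex_le_one [IsManifold (𝓡 4) ∞ X] (hP : SpinePresentation S u v ρ U O T₀ G k)
    {m : Fin 3} {x : X}
    (hx : x ∈ interior (S m)) (hc : IsMCriticalPt (𝓡 4) (G m) x) :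
    morseIndex (𝓡 4) (G m) x ≤ 1 := by
  by_contra hlt
  rw [not_le] at hlt
  have hfin : (interior (S m) ∩ criticalSetOfIndex (𝓡 4) (G m) (morseIndex (𝓡 4) (G m) x)).Finite :=
    (hP.finite_interior_inter_criticalSet m).subset fun y hy => ⟨hy.1, hy.2.1⟩
  have hempty : interior (S m) ∩ criticalSetOfIndex (𝓡 4) (G m) (morseIndex (𝓡 4) (G m) x) = ∅ := by
    rw [← Set.ncard_eq_zero hfin, hP.count, handleCount_of_two_le _ _ hlt]
  have hmem : x ∈ interior (S m) ∩ criticalSetOfIndex (𝓡 4) (G m) (morseIndex (𝓡 4) (G m) x) :=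
    ⟨hx, hc, rfl⟩
  rw [hempty] at hmem
  exact hmem

/-- `G m` has exactly one interior critical point of index `0` on `S m`. -/
theorem exists_index_zero (hP : SpinePresentation S u v ρ U O T₀ G k) (m : Fin 3) :
    ∃ p, interior (S m) ∩ criticalSetOfIndex (𝓡 4) (G m) 0 = {p} :=
  Set.ncard_eq_one.1 (by rw [hP.count]; rfl)

end SpinePresentation

end Presentation

/-! ## 3. The core of a sector as a regular sublevel set of the open sector -/

section Core

variable {X : Type} [TopologicalSpace X] [ChartedSpace (EuclideanSpace ℝ (Fin 4)) X]
  {S : Fin 3 → Set X} {u v : X → ℝ} {ρ : X → X} {U O T₀ : Set X} {G : Fin 3 → X → ℝ} {k : ℕ}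

/-- The open sector `interior (S m)`, an open submanifold of `X`. -/
def openSector (S : Fin 3 → Set X) (m : Fin 3) : TopologicalSpace.Opens X :=
  ⟨interior (S m), isOpen_interior⟩

/-- The presentation restricted to the open sector, `G m|_{interior (S m)}`. -/
def openSectorFun (S : Fin 3 → Set X) (G : Fin 3 → X → ℝ) (m : Fin 3) : openSector S m → ℝ :=
  G m ∘ Subtype.val

/-- `G m|_{interior (S m)}` is smooth. -/
theorem contMDiff_openSectorFun (hP : SpinePresentation S u v ρ U O T₀ G k) (m : Fin 3) :
    ContMDiff (𝓡 4) 𝓘(ℝ, ℝ) ∞ (openSectorFun S G m) :=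
  (hP.contMDiff_G m).comp contMDiff_subtype_val

/-- Critical points of `G m|_{interior (S m)}` are the interior critical points of `G m`. -/
theorem isMCriticalPt_openSectorFun_iff (hP : SpinePresentation S u v ρ U O T₀ G k) {m : Fin 3}
    (x : openSector S m) :
    IsMCriticalPt (𝓡 4) (openSectorFun S G m) x ↔ IsMCriticalPt (𝓡 4) (G m) x.1 :=
  isMCriticalPt_comp_subtype_val_opens_iff x ((hP.contMDiff_G m).mdifferentiableAt (by simp))

/-- **`G m|_{interior (S m)}` is a Morse function** (its Hessian at a critical point is the
Hessian of `G m` at an interior critical point, nondegenerate by the presentation).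
[cite: Milnor1963, §2] -/
theorem isMorse_openSectorFun (hP : SpinePresentation S u v ρ U O T₀ G k) (m : Fin 3) :
    IsMorse (𝓡 4) (openSectorFun S G m) := by
  refine ⟨contMDiff_openSectorFun hP m, fun x hx => ?_⟩
  rw [openSectorFun, mhessian_comp_subtype_val_opens]
  exact hP.nondeg m x.1 x.2 ((isMCriticalPt_openSectorFun_iff hP x).1 hx)

/-- A level above all interior critical values is a regular level of `G m|_{interior (S m)}`. -/
theorem isRegularLevel_openSectorFun (hP : SpinePresentation S u v ρ U O T₀ G k) {m : Fin 3}
    {lev : ℝ} (hCV : ∀ x ∈ interior (S m), IsMCriticalPt (𝓡 4) (G m) x → G m x < lev) :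
    IsRegularLevel (𝓡 4) (openSectorFun S G m) lev :=
  isRegularLevel_of_not_isMCriticalPt (contMDiff_openSectorFun hP m) fun x hx hc =>
    (hCV x.1 x.2 ((isMCriticalPt_openSectorFun_iff hP x).1 hc)).ne hx

/-- The core `{G m|_{interior (S m)} ≤ lev}`, `lev < 1`, is compact: its image in `X` is the
closed set `{x ∈ S m | G m x ≤ lev}`. -/
theorem isCompact_core [CompactSpace X] (hP : SpinePresentation S u v ρ U O T₀ G k) {m : Fin 3}
    {lev : ℝ} (hlev : lev < 1) : IsCompact (openSectorFun S G m ⁻¹' Iic lev) := by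
  have himg : (Subtype.val : openSector S m → X) '' (openSectorFun S G m ⁻¹' Iic lev) =
      S m ∩ G m ⁻¹' Iic lev := by
    ext x
    constructor
    · rintro ⟨y, hy, rfl⟩
      exact ⟨interior_subset y.2, hy⟩
    · rintro ⟨hx, hle⟩
      exact ⟨⟨x, hP.mem_interior_of_lt hx (lt_of_le_of_lt (show G m x ≤ lev from hle) hlev)⟩, hle, rfl⟩
  have hc : IsCompact (S m ∩ G m ⁻¹' Iic lev) :=
    (hP.tri.isCompact m).inter_right (isClosed_le (hP.contMDiff_G m).continuous continuous_const)
  rw [← himg] at hc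
  exact Topology.IsInducing.subtypeVal.isCompact_iff.2 hc

/-- **The core is connected** (Reeb: one interior critical point of index `0`, which lies in the
core when the level is above the critical values). [cite: Milnor1963, proof of Thm. 4.1] -/
theorem isConnected_core [CompactSpace X] (hP : SpinePresentation S u v ρ U O T₀ G k) {m : Fin 3}
    {lev : ℝ} (hlev : lev < 1) (hCV : ∀ x ∈ interior (S m), IsMCriticalPt (𝓡 4) (G m) x → G m x < lev) :
    IsConnected (openSectorFun S G m ⁻¹' Iic lev) := by
  obtain ⟨p, hp⟩ := hP.exists_index_zero m
  have hpmem : p ∈ interior (S m) ∩ criticalSetOfIndex (𝓡 4) (G m) 0 := by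
    rw [hp]; exact mem_singleton p
  refine isConnected_preimage_Iic_of_isCompact ((contMDiff_openSectorFun hP m).of_le (by norm_cast))
    (fun x hx y hy => ?_) (isCompact_core hP hlev) ⟨⟨p, hpmem.1⟩, (hCV p hpmem.1 hpmem.2.1).le⟩
  have hmem : ∀ z : openSector S m, z ∈ criticalSetOfIndex (𝓡 4) (openSectorFun S G m) 0 →
      z.1 ∈ interior (S m) ∩ criticalSetOfIndex (𝓡 4) (G m) 0 := fun z hz =>
    ⟨z.2, (isMCriticalPt_openSectorFun_iff hP z).1 hz.1, by
      rw [← morseIndex_comp_subtype_val_opens (I := 𝓡 4) (U := openSector S m) (G m) z]; exact hz.2⟩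
  have hx' := hmem x hx
  have hy' := hmem y hy
  rw [hp] at hx' hy'
  exact Subtype.ext (hx'.trans hy'.symm)

/-- **The core is a `1`-handlebody**: on the regular sublevel set `{G m|_U ≤ lev}` of the open
sector `U`, `G m|_U + (1 - lev)` is a Morse function adapted to the boundary whose critical
points are interior critical points of `G m`, of index `≤ 1`. [cite: Milnor1963, Thm. 3.1] -/
theorem isHandlebody_core [IsManifold (𝓡 4) ∞ X] (hP : SpinePresentation S u v ρ U O T₀ G k)
    {m : Fin 3} {lev : ℝ} (hreg : IsRegularLevel (𝓡 4) (openSectorFun S G m) lev) :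
    IsHandlebodyOfIndexLE 3 1 (RegularSublevel hreg) := by
  obtain ⟨hadapt, hcrit, hidx⟩ := RegularSublevel.morseData (isMorse_openSectorFun hP m) hreg
  refine ⟨_, hadapt, fun z hz => ?_⟩
  have hz' := (hcrit z).1 hz
  have hEq : morseIndex (𝓡 4) (openSectorFun S G m) (RegularSublevel.incl hreg z) =
      morseIndex (𝓡 4) (G m) (RegularSublevel.incl hreg z).1 :=
    morseIndex_comp_subtype_val_opens (I := 𝓡 4) (G m) _
  rw [hidx z hz', hEq]
  exact hP.morseIndex_le_one (RegularSublevel.incl hreg z).2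
    ((isMCriticalPt_openSectorFun_iff hP _).1 hz')

/-- The core is a compact space. -/
theorem compactSpace_core [CompactSpace X] (hP : SpinePresentation S u v ρ U O T₀ G k) {m : Fin 3}
    {lev : ℝ} (hlev : lev < 1) (hreg : IsRegularLevel (𝓡 4) (openSectorFun S G m) lev) :
    CompactSpace (RegularSublevel hreg) :=
  isCompact_iff_compactSpace.1 (isCompact_core hP hlev)

/-- The core is a connected space. [cite: Milnor1963, proof of Thm. 4.1] -/
theorem connectedSpace_core [CompactSpace X] (hP : SpinePresentation S u v ρ U O T₀ G k) {m : Fin 3}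
    {lev : ℝ} (hlev : lev < 1) (hCV : ∀ x ∈ interior (S m), IsMCriticalPt (𝓡 4) (G m) x → G m x < lev)
    (hreg : IsRegularLevel (𝓡 4) (openSectorFun S G m) lev) :
    ConnectedSpace (RegularSublevel hreg) :=
  isConnected_iff_connectedSpace.1 (isConnected_core hP hlev hCV)

/-- **The core is orientable**: pull back the orientation of `X`, restricted to the open sector,
along the inclusion of the regular sublevel set. [cite: HirschDT1976, §4.4 p. 101] -/
theorem isOrientable_core [IsManifold (𝓡 4) ∞ X] (o : SmoothOrientation (𝓡 4) X) {m : Fin 3}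
    {lev : ℝ} (hreg : IsRegularLevel (𝓡 4) (openSectorFun S G m) lev) :
    IsOrientable (𝓡∂ 4) (RegularSublevel hreg) :=
  RegularSublevel.isOrientable hreg ⟨o.restrict (openSector S m)⟩

end Core

/-! ## 4. The registered helper stub -/

/-- **The Morse toolkit of the cores** (registered helper stub of `stub_cores`): (1) Reeb's
argument for a compact sublevel set on a manifold without boundary; (2) for a normalised
presentation, a sector `m` and a level `lev < 1` above the interior critical values of `G m`:
the interior critical points of `G m` are finite, and the core — the regular sublevel set of
`G m|_{interior (S m)}` at `lev` — is a compact connected orientable `1`-handlebody.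
(A conjunction of statements PROVED in this file — `stub_coresMorseToolkit` —, not a named fact.) -/
def CoresMorseToolkit : Prop :=
  (∀ (n : ℕ) (M : Type) [TopologicalSpace M] [ChartedSpace (EuclideanSpace ℝ (Fin (n + 1))) M]
    (f : M → ℝ) (a : ℝ), ContMDiff (𝓡 (n + 1)) 𝓘(ℝ, ℝ) 2 f →
    (criticalSetOfIndex (𝓡 (n + 1)) f 0).Subsingleton → IsCompact (f ⁻¹' Iic a) →
    (f ⁻¹' Iic a).Nonempty → IsConnected (f ⁻¹' Iic a)) ∧
  (∀ (X : Type) [TopologicalSpace X] [ChartedSpace (EuclideanSpace ℝ (Fin 4)) X]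
    [IsManifold (𝓡 4) ∞ X] [CompactSpace X] (o : SmoothOrientation (𝓡 4) X)
    (S : Fin 3 → Set X) (u v : X → ℝ) (ρ : X → X) (U O T₀ : Set X) (G : Fin 3 → X → ℝ) (k : ℕ)
    (_ : SpinePresentation S u v ρ U O T₀ G k) (m : Fin 3) (lev : ℝ), lev < 1 →
    (∀ x ∈ interior (S m), IsMCriticalPt (𝓡 4) (G m) x → G m x < lev) →
    (interior (S m) ∩ criticalSet (𝓡 4) (G m)).Finite ∧
    ∃ hreg : IsRegularLevel (𝓡 4) (openSectorFun S G m) lev,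
      CompactSpace (RegularSublevel hreg) ∧ ConnectedSpace (RegularSublevel hreg) ∧
      IsHandlebodyOfIndexLE 3 1 (RegularSublevel hreg) ∧ IsOrientable (𝓡∂ 4) (RegularSublevel hreg))

/-- **Registered helper stub `stub_coresMorseToolkit`** of line `lp-by-sphere-system-surgery`
(Morse toolkit for the cores of `stub_cores`). [cite: Milnor1963, Thm. 3.1 and proof of Thm. 4.1] -/
theorem stub_coresMorseToolkit : CoresMorseToolkit :=
  ⟨fun _ _ _ _ _ _ hf h0 hK hne => isConnected_preimage_Iic_of_isCompact hf h0 hK hne,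
    fun _ _ _ _ _ o _ _ _ _ _ _ _ _ _ hP m _ hlev hCV =>
      ⟨hP.finite_interior_inter_criticalSet m, isRegularLevel_openSectorFun hP hCV,
        compactSpace_core hP hlev _, connectedSpace_core hP hlev hCV _, isHandlebody_core hP _,
        isOrientable_core o _⟩⟩

end Summit.SmoothPoincare4.SmoothPoincare4.Cruxes.AgkCor6Sufficiency.LpBySphereSystemSurgery

end
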